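import Mathlib.Data.Nat.Pairing
import Mathlib.Data.Finset.Sort
import Mathlib.Analysis.SpecialFunctions.Pow.Real
import Literature.Computability.Complexity.CNF
import Literature.Computability.MetaComplexity.Resolution
import Literature.Computability.MetaComplexity.ResolutionRecords
import HarnessLib

/-!
# Garlík's levelled refutation statement `REF^F_{s,t}` and its Resolution lower bound

Garlík [Garlík 2019] proves Resolution length lower bounds for *refutation statements*: CNFs
expressing "the CNF `F` has a Resolution refutation of a given shape", lines encoded in unary.
His formula `REF^F_{s,t}` insists that the described refutation is *levelled*: `s` levels of `t`
clauses `C_{i,j}`, every clause of level `1` a weakening of a clause of `F`, every clause of level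
`i > 1` a weakening of the resolvent of two clauses of level `i - 1`, and `C_{s,t} = ∅`
[Garlík 2019, Def. 5]; this refutation system quadratically simulates Resolution
[Garlík 2019, Prop. 6]. The main theorem [Garlík 2019, Thm 1]: for unsatisfiable `F` with `r`
clauses in `n` variables and `t ≥ s ≥ n+1`, `r ≥ n ≥ 2`, `t ≥ r^{3+ε}`, `t ≥ t₀(ε)`, every
Resolution refutation of `REF^F_{s,t}` has length `> 2^{t^δ}`.

This file transcribes the fifteen clause families of `REF^F_{s,t}` [Garlík 2019, §3, the display
after Prop. 6] and states Theorem 1 as a named fact: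

* `LRefVar` — the variables `D(i,j,ℓ,b)`, `L(i,j,j')`, `R(i,j,j')`, `V(i,j,ℓ)`, `I(j,m)` with an
  injective numbering `LRefVar.code` (left inverse `LRefVar.decode`);
* `LevelledRefCNF.B1 … B15` — the clause families, `LevelledRefCNF.lref X F s t : CNF LRefVar`;
* `levelledRefCNF F s t : CNF ℕ` — over variables `ℕ`, the variables of `F` being its occurring
  variables in increasing order (`n = |vars F|`, `r = |F|`);
* `levelledRefCNF_lowerBound` — [Garlík 2019, Thm 1].

The companion file `RefutationCNF.lean` treats the unlevelled `REF(F,s)` / `RREF(F,s)` of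
Pudlák and Atserias–Müller.

## Index conventions (ours ↔ paper)

0-based throughout: level `i < s` is the paper's level `i+1` (so our level `0` is the axiom
level "1"), position `j < t` is the paper's `j+1`, variable index `ℓ < n` is the paper's
`x_{ℓ+1}`, namely the variable `X[ℓ]` of `F`, clause index `m < r` is `C_{m+1} = F[m]`. Families
quantifying over levels `i ∈ [s] ∖ {1}` together with level `i - 1` are generated over the lower
level `p` with `p + 1 < s` (upper level `p + 1`), and "the clause `C_{s,t}`" is the pair of the
`i < s` with `i + 1 = s` and the `j < t` with `j + 1 = t`; no natural subtraction occurs.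
Semantics [Garlík 2019, §3]: `D(i,j,ℓ,b)` — the literal `x_ℓ^b` (`b = true`: positive) is in
`C_{i,j}`; `L(i,j,j')` (`R(i,j,j')`) — `C_{i-1,j'}` is the premise of the cut producing `C_{i,j}`
that contains the positive (negative) literal of the cut variable; `V(i,j,ℓ)` — `C_{i,j}` is
obtained by a cut on `x_ℓ`; `I(j,m)` — `C_{1,j}` is a weakening of `C_m`.

## Design notes

* At-most-one families range over ordered pairs as printed; family (B1) ranges over the literal
  occurrences of the list-clause `F[m]`, a literal `(x,b)` becoming `D(0, j, X.idxOf x, b)`.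
* Degenerate parameters (`s = 0` or `t = 0`, excluded by the theorem's `t ≥ s ≥ n + 1 ≥ 3`) give
  harmless junk (empty families).
* As in `RefutationCNF.lean`, the fact is stated for our Resolution system (`IsResRefutation`:
  explicit weakening rule, tautological lines permitted); length lower bounds transfer verbatim
  from Garlík's system (weakening built into the rule; a refutation in our sense is one in his of
  the same length after composing weakenings). We add the hypothesis that the clauses of `F` are
  non-tautological (a tautological `F[m]` only creates a dead value of `I`), which the intended
  inputs satisfy.

## References

* M. Garlík, *Resolution lower bounds for refutation statements*, MFCS 2019, LIPIcs 138,
  37:1–37:13; full version arXiv:1905.12372 (Def. 5, Prop. 6, the clause list of §3, Thm 1).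
* A. Atserias, M. Müller, *Automating Resolution is NP-hard*, J. ACM 67 (2020) (the question
  answered by Garlík's theorem, §7 of arXiv:1904.02991).
-/

namespace Literature.Computability.MetaComplexity

open _root_.Computability Complexity

/-! ### Variables and their numbering -/

/-- The propositional variables of Garlík's `REF^F_{s,t}` (0-based indices): `D i j ℓ b` —
"the literal `x_ℓ^b` is in `C_{i,j}`"; `L i j j'` / `R i j j'` — "`C_{i-1,j'}` is the premise of
the cut producing `C_{i,j}` containing the positive / negative literal of the cut variable";
`V i j ℓ` — "`C_{i,j}` is obtained by a cut on `x_ℓ`"; `I j m` — "`C_{1,j}` is a weakening of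
the clause `C_m` of `F`". [cite: Garlik2019, §3 (variables of REF^F_{s,t})] -/
inductive LRefVar : Type
  /-- `D(i,j,ℓ,b)`: the literal `x_ℓ^b` occurs in the clause `C_{i,j}` -/
  | D (i j ℓ : ℕ) (b : Bool) : LRefVar
  /-- `L(i,j,j')`: `C_{i-1,j'}` is the premise of `C_{i,j}` containing the cut variable
  positively -/
  | L (i j j' : ℕ) : LRefVar
  /-- `R(i,j,j')`: `C_{i-1,j'}` is the premise of `C_{i,j}` containing the cut variable
  negatively -/
  | R (i j j' : ℕ) : LRefVar
  /-- `V(i,j,ℓ)`: `C_{i,j}` is obtained by a cut on `x_ℓ` -/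
  | V (i j ℓ : ℕ) : LRefVar
  /-- `I(j,m)`: the level-1 clause `C_{1,j}` is a weakening of `C_m ∈ F` -/
  | I (j m : ℕ) : LRefVar
  deriving DecidableEq, Repr

namespace LRefVar

/-- An injective numbering of the variables by naturals: residue mod `5` = kind, quotient = the
iterated pairing `Nat.pair` of the indices (the Boolean of `D` merged into `2ℓ + b`).
[folklore] -/
def code : LRefVar → ℕ
  | D i j ℓ b => 5 * Nat.pair i (Nat.pair j (2 * ℓ + b.toNat))
  | L i j j' => 5 * Nat.pair i (Nat.pair j j') + 1
  | R i j j' => 5 * Nat.pair i (Nat.pair j j') + 2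
  | V i j ℓ => 5 * Nat.pair i (Nat.pair j ℓ) + 3
  | I j m => 5 * Nat.pair j m + 4

/-- Decoding a natural number to a variable (a left inverse of `code`). [folklore] -/
def decode (k : ℕ) : LRefVar :=
  let q := k / 5
  let a := q.unpair.1
  let c := q.unpair.2.unpair.1
  let w := q.unpair.2.unpair.2
  if k % 5 = 0 then D a c (w / 2) (decide (w % 2 = 1))
  else if k % 5 = 1 then L a c w
  else if k % 5 = 2 then R a c w
  else if k % 5 = 3 then V a c w
  else I q.unpair.1 q.unpair.2

/-- `decode` is a left inverse of `code`. [folklore] -/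
@[simp] theorem decode_code (x : LRefVar) : decode (code x) = x := by
  have hdiv : ∀ q r : ℕ, r < 5 → (5 * q + r) / 5 = q := fun q r hr => by omega
  have hmod : ∀ q r : ℕ, r < 5 → (5 * q + r) % 5 = r := fun q r hr => by omega
  cases x with
  | D i j ℓ b =>
    have h2 : (2 * ℓ + b.toNat) / 2 = ℓ := by
      cases b <;> simp only [Bool.toNat_false, Bool.toNat_true] <;> omega
    have h3 : decide ((2 * ℓ + b.toNat) % 2 = 1) = b := by
      cases b
      · simp only [Bool.toNat_false, decide_eq_false_iff_not]; omega
      · simp only [Bool.toNat_true, decide_eq_true_eq]; omega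
    have h1 : (5 * Nat.pair i (Nat.pair j (2 * ℓ + b.toNat))) / 5 =
        Nat.pair i (Nat.pair j (2 * ℓ + b.toNat)) := by omega
    have h0 : (5 * Nat.pair i (Nat.pair j (2 * ℓ + b.toNat))) % 5 = 0 := by omega
    simp only [decode, code, h1, h0, Nat.unpair_pair, h2, h3]
    simp
  | L i j j' =>
    simp only [decode, code, hdiv _ 1 (by norm_num), hmod _ 1 (by norm_num), Nat.unpair_pair]
    simp
  | R i j j' =>
    simp only [decode, code, hdiv _ 2 (by norm_num), hmod _ 2 (by norm_num), Nat.unpair_pair]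
    simp
  | V i j ℓ =>
    simp only [decode, code, hdiv _ 3 (by norm_num), hmod _ 3 (by norm_num), Nat.unpair_pair]
    simp
  | I j m =>
    simp only [decode, code, hdiv _ 4 (by norm_num), hmod _ 4 (by norm_num), Nat.unpair_pair]
    simp

/-- The numbering of the variables is injective. [folklore] -/
theorem code_injective : Function.Injective code :=
  Function.LeftInverse.injective decode_code

end LRefVar

/-! ### The fifteen clause families -/

namespace LevelledRefCNF

/-- The lower levels `p` having an upper level `p + 1 < s` (the paper's `i - 1` for
`i ∈ [s] ∖ {1}`). [folklore] -/
def lowerLevels (s : ℕ) : List ℕ :=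
  (List.range s).filter (· + 1 < s)

/-- (B1) `¬I(j,m) ∨ D(1,j,ℓ,b)` for `j ∈ [t]`, `m ∈ [r]`, `x_ℓ^b ∈ C_m`: a level-1 clause contains
the clause of `F` assigned to it (`C_m = F[m]`; the literal `(x,b)` of `F` is `x_ℓ^b` for
`ℓ = X.idxOf x`). [cite: Garlik2019, §3 (clauses of REF^F_{s,t}, 1st family)] -/
def B1 (X : List ℕ) (F : CNF ℕ) (t : ℕ) : CNF LRefVar :=
  (List.range t).flatMap fun j => (List.range F.length).flatMap fun m =>
    (F.getD m []).map fun l => [(LRefVar.I j m, false), (LRefVar.D 0 j (X.idxOf l.1) l.2, true)]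

/-- (B2) `¬D(i,j,ℓ,1) ∨ ¬D(i,j,ℓ,0)` for `i ∈ [s]`, `j ∈ [t]`, `ℓ ∈ [n]`: no clause `C_{i,j}` is
tautological. [cite: Garlik2019, §3 (clauses of REF^F_{s,t}, 2nd family)] -/
def B2 (s t n : ℕ) : CNF LRefVar :=
  (List.range s).flatMap fun i => (List.range t).flatMap fun j => (List.range n).map fun ℓ =>
    [(LRefVar.D i j ℓ true, false), (LRefVar.D i j ℓ false, false)]

/-- (B3) `¬L(i,j,j') ∨ ¬V(i,j,ℓ) ∨ D(i-1,j',ℓ,1)` for `i ∈ [s] ∖ {1}`, `j, j' ∈ [t]`, `ℓ ∈ [n]`: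
the `L`-premise of a cut on `x_ℓ` contains `x_ℓ`.
[cite: Garlik2019, §3 (clauses of REF^F_{s,t}, 3rd family)] -/
def B3 (s t n : ℕ) : CNF LRefVar :=
  (lowerLevels s).flatMap fun p => (List.range t).flatMap fun j =>
    (List.range t).flatMap fun j' => (List.range n).map fun ℓ =>
      [(LRefVar.L (p + 1) j j', false), (LRefVar.V (p + 1) j ℓ, false),
        (LRefVar.D p j' ℓ true, true)]

/-- (B4) `¬R(i,j,j') ∨ ¬V(i,j,ℓ) ∨ D(i-1,j',ℓ,0)` for `i ∈ [s] ∖ {1}`, `j, j' ∈ [t]`, `ℓ ∈ [n]`: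
the `R`-premise of a cut on `x_ℓ` contains `¬x_ℓ`.
[cite: Garlik2019, §3 (clauses of REF^F_{s,t}, 4th family)] -/
def B4 (s t n : ℕ) : CNF LRefVar :=
  (lowerLevels s).flatMap fun p => (List.range t).flatMap fun j =>
    (List.range t).flatMap fun j' => (List.range n).map fun ℓ =>
      [(LRefVar.R (p + 1) j j', false), (LRefVar.V (p + 1) j ℓ, false),
        (LRefVar.D p j' ℓ false, true)]

/-- (B5) `¬L(i,j,j') ∨ ¬V(i,j,ℓ) ∨ ¬D(i-1,j',ℓ',b) ∨ D(i,j,ℓ',b)` for `i ∈ [s] ∖ {1}`,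
`j, j' ∈ [t]`, `ℓ, ℓ' ∈ [n]`, `b ∈ {0,1}`, `(ℓ',b) ≠ (ℓ,1)`: the resolvent keeps every literal
of its `L`-premise other than `x_ℓ`. [cite: Garlik2019, §3 (clauses of REF^F_{s,t}, 5th family)] -/
def B5 (s t n : ℕ) : CNF LRefVar :=
  (lowerLevels s).flatMap fun p => (List.range t).flatMap fun j =>
    (List.range t).flatMap fun j' => (List.range n).flatMap fun ℓ =>
      (List.range n).flatMap fun ℓ' =>
        ([false, true].filter fun b => !(decide (ℓ' = ℓ) && b)).map fun b =>
          [(LRefVar.L (p + 1) j j', false), (LRefVar.V (p + 1) j ℓ, false),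
            (LRefVar.D p j' ℓ' b, false), (LRefVar.D (p + 1) j ℓ' b, true)]

/-- (B6) `¬R(i,j,j') ∨ ¬V(i,j,ℓ) ∨ ¬D(i-1,j',ℓ',b) ∨ D(i,j,ℓ',b)` for `i ∈ [s] ∖ {1}`,
`j, j' ∈ [t]`, `ℓ, ℓ' ∈ [n]`, `b ∈ {0,1}`, `(ℓ',b) ≠ (ℓ,0)`: the resolvent keeps every literal
of its `R`-premise other than `¬x_ℓ`.
[cite: Garlik2019, §3 (clauses of REF^F_{s,t}, 6th family)] -/
def B6 (s t n : ℕ) : CNF LRefVar :=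
  (lowerLevels s).flatMap fun p => (List.range t).flatMap fun j =>
    (List.range t).flatMap fun j' => (List.range n).flatMap fun ℓ =>
      (List.range n).flatMap fun ℓ' =>
        ([false, true].filter fun b => !(decide (ℓ' = ℓ) && !b)).map fun b =>
          [(LRefVar.R (p + 1) j j', false), (LRefVar.V (p + 1) j ℓ, false),
            (LRefVar.D p j' ℓ' b, false), (LRefVar.D (p + 1) j ℓ' b, true)]

/-- (B7) `¬D(s,t,ℓ,b)` for `ℓ ∈ [n]`, `b ∈ {0,1}`: the clause `C_{s,t}` is empty (last level,
last position; no clause if `s = 0` or `t = 0`).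
[cite: Garlik2019, §3 (clauses of REF^F_{s,t}, 7th family)] -/
def B7 (s t n : ℕ) : CNF LRefVar :=
  ((List.range s).filter (· + 1 = s)).flatMap fun i =>
    ((List.range t).filter (· + 1 = t)).flatMap fun j => (List.range n).flatMap fun ℓ =>
      [false, true].map fun b => [(LRefVar.D i j ℓ b, false)]

/-- (B8) `V(i,j,1) ∨ ⋯ ∨ V(i,j,n)` for `i ∈ [s] ∖ {1}`, `j ∈ [t]`: every upper-level clause has a
cut variable. [cite: Garlik2019, §3 (clauses of REF^F_{s,t}, 8th family)] -/
def B8 (s t n : ℕ) : CNF LRefVar :=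
  (lowerLevels s).flatMap fun p => (List.range t).map fun j =>
    (List.range n).map fun ℓ => (LRefVar.V (p + 1) j ℓ, true)

/-- (B9) `I(j,1) ∨ ⋯ ∨ I(j,r)` for `j ∈ [t]`: every level-1 clause is assigned a clause of `F`.
[cite: Garlik2019, §3 (clauses of REF^F_{s,t}, 9th family)] -/
def B9 (t r : ℕ) : CNF LRefVar :=
  (List.range t).map fun j => (List.range r).map fun m => (LRefVar.I j m, true)

/-- (B10) `L(i,j,1) ∨ ⋯ ∨ L(i,j,t)` for `i ∈ [s] ∖ {1}`, `j ∈ [t]`: every upper-level clause has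
an `L`-premise. [cite: Garlik2019, §3 (clauses of REF^F_{s,t}, 10th family)] -/
def B10 (s t : ℕ) : CNF LRefVar :=
  (lowerLevels s).flatMap fun p => (List.range t).map fun j =>
    (List.range t).map fun j' => (LRefVar.L (p + 1) j j', true)

/-- (B11) `R(i,j,1) ∨ ⋯ ∨ R(i,j,t)` for `i ∈ [s] ∖ {1}`, `j ∈ [t]`: every upper-level clause has
an `R`-premise. [cite: Garlik2019, §3 (clauses of REF^F_{s,t}, 11th family)] -/
def B11 (s t : ℕ) : CNF LRefVar :=
  (lowerLevels s).flatMap fun p => (List.range t).map fun j =>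
    (List.range t).map fun j' => (LRefVar.R (p + 1) j j', true)

/-- (B12) `¬V(i,j,ℓ) ∨ ¬V(i,j,ℓ')` for `i ∈ [s] ∖ {1}`, `j ∈ [t]`, `ℓ ≠ ℓ' ∈ [n]` (ordered
pairs): the cut variable is unique. [cite: Garlik2019, §3 (clauses of REF^F_{s,t}, 12th family)]
-/
def B12 (s t n : ℕ) : CNF LRefVar :=
  (lowerLevels s).flatMap fun p => (List.range t).flatMap fun j =>
    (List.range n).flatMap fun ℓ => ((List.range n).filter (· ≠ ℓ)).map fun ℓ' =>
      [(LRefVar.V (p + 1) j ℓ, false), (LRefVar.V (p + 1) j ℓ', false)]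

/-- (B13) `¬I(j,m) ∨ ¬I(j,m')` for `j ∈ [t]`, `m ≠ m' ∈ [r]`: the assigned clause of `F` is
unique. [cite: Garlik2019, §3 (clauses of REF^F_{s,t}, 13th family)] -/
def B13 (t r : ℕ) : CNF LRefVar :=
  (List.range t).flatMap fun j => (List.range r).flatMap fun m =>
    ((List.range r).filter (· ≠ m)).map fun m' =>
      [(LRefVar.I j m, false), (LRefVar.I j m', false)]

/-- (B14) `¬L(i,j,j') ∨ ¬L(i,j,j'')` for `i ∈ [s] ∖ {1}`, `j ∈ [t]`, `j' ≠ j'' ∈ [t]`: the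
`L`-premise is unique. [cite: Garlik2019, §3 (clauses of REF^F_{s,t}, 14th family)] -/
def B14 (s t : ℕ) : CNF LRefVar :=
  (lowerLevels s).flatMap fun p => (List.range t).flatMap fun j =>
    (List.range t).flatMap fun j' => ((List.range t).filter (· ≠ j')).map fun j'' =>
      [(LRefVar.L (p + 1) j j', false), (LRefVar.L (p + 1) j j'', false)]

/-- (B15) `¬R(i,j,j') ∨ ¬R(i,j,j'')` for `i ∈ [s] ∖ {1}`, `j ∈ [t]`, `j' ≠ j'' ∈ [t]`: the
`R`-premise is unique. [cite: Garlik2019, §3 (clauses of REF^F_{s,t}, 15th family)] -/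
def B15 (s t : ℕ) : CNF LRefVar :=
  (lowerLevels s).flatMap fun p => (List.range t).flatMap fun j =>
    (List.range t).flatMap fun j' => ((List.range t).filter (· ≠ j')).map fun j'' =>
      [(LRefVar.R (p + 1) j j', false), (LRefVar.R (p + 1) j j'', false)]

/-- Garlík's refutation statement `REF^F_{s,t}` as a CNF over `LRefVar`: the union of the fifteen
families, for the CNF `F` with variable list `X` (`n := |X|`, `r := |F|`), `s` levels and `t`
clauses per level; it expresses that `F` has a resolution refutation of `s` levels of `t`
clauses. [cite: Garlik2019, §3 (definition of REF^F_{s,t})] -/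
def lref (X : List ℕ) (F : CNF ℕ) (s t : ℕ) : CNF LRefVar :=
  B1 X F t ++ B2 s t X.length ++ B3 s t X.length ++ B4 s t X.length ++ B5 s t X.length ++
  B6 s t X.length ++ B7 s t X.length ++ B8 s t X.length ++ B9 t F.length ++ B10 s t ++
  B11 s t ++ B12 s t X.length ++ B13 t F.length ++ B14 s t ++ B15 s t

/-- Renumbering a CNF over `LRefVar` into a CNF over `ℕ` along `LRefVar.code`. [folklore] -/
def toNat (φ : CNF LRefVar) : CNF ℕ :=
  φ.map fun C => C.map fun l => (l.1.code, l.2)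

end LevelledRefCNF

/-- `levelledRefCNF F s t = REF^F_{s,t}` as a CNF over variables `ℕ`: the variables of `F` are its
occurring variables in increasing order (so `n = |vars F|`), and the variables of `REF^F_{s,t}`
are numbered by `LRefVar.code`. [cite: Garlik2019, §3 (REF^F_{s,t})] -/
def levelledRefCNF (F : CNF ℕ) (s t : ℕ) : CNF ℕ :=
  LevelledRefCNF.toNat (LevelledRefCNF.lref ((CNF.vars F).sort (· ≤ ·)) F s t)

/-! ### Unfolding and transport lemmas -/

/-- Unfolding `levelledRefCNF`. [cite: Garlik2019, §3] -/
theorem levelledRefCNF_eq (F : CNF ℕ) (s t : ℕ) :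
    levelledRefCNF F s t =
      LevelledRefCNF.toNat (LevelledRefCNF.lref ((CNF.vars F).sort (· ≤ ·)) F s t) := rfl

/-- With no levels there are no clauses at all (`s = 0` is excluded by the theorem's
`s ≥ n + 1 ≥ 3`; documented junk). [folklore] -/
theorem LevelledRefCNF.lref_zero_levels (X : List ℕ) (F : CNF ℕ) :
    LevelledRefCNF.lref X F 0 0 = [] := by
  simp [LevelledRefCNF.lref, LevelledRefCNF.lowerLevels, LevelledRefCNF.B1, LevelledRefCNF.B2,
    LevelledRefCNF.B3, LevelledRefCNF.B4, LevelledRefCNF.B5, LevelledRefCNF.B6, LevelledRefCNF.B7,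
    LevelledRefCNF.B8, LevelledRefCNF.B9, LevelledRefCNF.B10, LevelledRefCNF.B11,
    LevelledRefCNF.B12, LevelledRefCNF.B13, LevelledRefCNF.B14, LevelledRefCNF.B15]

/-- Renumbering along `LRefVar.code` preserves the value under the transported assignment.
[folklore] -/
theorem LevelledRefCNF.eval_toNat (φ : CNF LRefVar) (σ : ℕ → Bool) :
    (LevelledRefCNF.toNat φ).eval σ = φ.eval (fun x => σ x.code) := by
  induction φ with
  | nil => rfl
  | cons C φ ih =>
    simp only [LevelledRefCNF.toNat, List.map_cons, CNF.eval_cons] at ih ⊢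
    rw [ih]
    congr 1
    simp only [Clause.eval, List.any_map]
    congr 1

/-- Renumbering along `LRefVar.code` preserves satisfiability (both directions). [folklore] -/
theorem LevelledRefCNF.satisfiable_toNat_iff (φ : CNF LRefVar) :
    (LevelledRefCNF.toNat φ).Satisfiable ↔ φ.Satisfiable := by
  constructor
  · rintro ⟨σ, hσ⟩
    exact ⟨fun x => σ x.code, by rwa [LevelledRefCNF.eval_toNat] at hσ⟩
  · rintro ⟨τ, hτ⟩
    refine ⟨fun k => τ (LRefVar.decode k), ?_⟩
    rw [LevelledRefCNF.eval_toNat]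
    simpa using hτ

/-- Clause counts are preserved by the renumbering. [folklore] -/
@[simp] theorem LevelledRefCNF.length_toNat (φ : CNF LRefVar) :
    (LevelledRefCNF.toNat φ).length = φ.length :=
  List.length_map _

/-! ### Named fact: Garlík's lower bound -/

/-- **Garlík's lower bound for levelled refutation statements** [Garlík 2019, Thm 1]: for each
`ε > 0` there are `δ > 0` and `t₀` such that if `t ≥ s ≥ n + 1`, `r ≥ n ≥ 2`, `t ≥ r^{3+ε}`,
`t ≥ t₀`, and `F` is an unsatisfiable CNF consisting of `r` clauses in `n` variables, then every
Resolution refutation of `REF^F_{s,t}` has length `> 2^{t^δ}`. Stated for `levelledRefCNF`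
(`n = |vars F|`, `r = |F|`), for our Resolution system (length lower bounds transfer verbatim),
and with the extra hypothesis that the clauses of `F` are non-tautological.
[cite: Garlik2019, Thm 1] -/
def levelledRefCNF_lowerBound : Prop :=
  ∀ ε : ℝ, 0 < ε → ∃ δ : ℝ, 0 < δ ∧ ∃ t₀ : ℕ, ∀ (F : CNF ℕ) (s t : ℕ),
    s ≤ t → (CNF.vars F).card + 1 ≤ s → 2 ≤ (CNF.vars F).card → (CNF.vars F).card ≤ F.length →
    ((F.length : ℝ)) ^ (3 + ε) ≤ (t : ℝ) → t₀ ≤ t →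
    (∀ C ∈ F.clauseFinsets, IsNonTaut C) → ¬ F.Satisfiable →
      ∀ π : List (ResLine ℕ), IsResRefutation (levelledRefCNF F s t) π →
        (2 : ℝ) ^ ((t : ℝ) ^ δ) < π.length

end Literature.Computability.MetaComplexity
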